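import Literature.AnabelianGeometry.EtaleTheta.ThetaCoversTempered
import Mathlib.Topology.Algebra.OpenSubgroup

/-!
# [EtTh] §2 interface audit: compactness of `Π_C` and finite index of `Π_{C̲̲}` over
# `ThetaCovers.TemperedCoverData` (proof-only; v2 — the F1 witnesses of v1 retired with the repair)

Mochizuki, *The Étale Theta Function …* [EtTh], Publ. RIMS 45 (2009), §2, PRIMS text pp.35–40
(locators `p.N` = PDF pages; bib key `MochizukiEtTh2009`): "`1 → Δ_X → Π_X → G_K → 1`" (p.35) with
`K` "a finite extension of `ℚ_p`" (p.39), so that `G_K = Gal(K̄/K)` is an infinite profinite group.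

PROOF-ONLY companion (no `def`, no new named fact) of `ThetaCovers.lean` / `ThetaCoversTempered.lean`
(seat abc-iut-L2-t2), written for plan/L2/ASSIGNMENTS.md §J row W3-L2-02 (seat abc-iut-L2-d3).

HISTORY (plan/GAP-LEDGER G-L2d3-5). v1 of this file (p416998) was the kernel witness of finding F1: the
v1/v2 interface field `CoverData.isOpen_barKer : IsOpen (barKer : Set PiC)` ("`Ker(Δ_X ↠ Δ̄_X)` open
in `Π_C`"), together with `barKer ≤ barTheta ≤ Π_X ∩ Ker(aug)` and the compactness of `Π_C` (target of
the profinite completion map `toHat`), forced `Finite T.GK` for every `T : TemperedCoverData l` — so the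
interface admitted no instance at the arithmetic [EtTh] model (`G_K = Gal(ℚ̄_p/K)` infinite). The repair
(L2-lead ruling 2026-08-26T02:06:46Z) replaces that field by `CoverData.isClosed_barKer` and adds
`TemperedCoverData.isOpen_PiCuu'` ("`Π_{C̲̲}` open in `Π_C`", Def 2.3); the theorems `finite_GK`,
`isOpen_ker_aug`, `finiteIndex_barKer`, … of v1 are accordingly RETIRED here (they are no longer
derivable, as intended). What remains: `Π_C` is compact, `Π_C → G_K` is onto, and the chosen finite
coverings `C̲̲`, `X̲̲` have finite index in `Π_C`. Nothing here takes a side on [IUTchIII] Cor 3.12;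
typed ≠ proved.
-/

namespace Literature.AnabelianGeometry.EtaleTheta

namespace ThetaCovers

universe u

namespace CoverData

variable {l : ℕ} (X : CoverData.{u} l)

/-- `Π_C → G_K` is surjective (already `Π_X ↠ G_K`, field `aug_PiX_surjective`).
[cite: MochizukiEtTh2009, Def 2.1 p.35] -/
theorem aug_surjective : Function.Surjective X.aug := fun g => by
  obtain ⟨x, hx⟩ := X.aug_PiX_surjective g
  exact ⟨x, hx⟩

end CoverData

namespace TemperedCoverData

variable {l : ℕ} (T : TemperedCoverData.{u} l)

/-- `Π_C` is compact: it is the target of the profinite completion map `Π^tp_C → Π_C`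
(field `isProfiniteCompletion_toHat`). [cite: MochizukiEtTh2009, Prop 2.4 p.38] -/
theorem compactSpace_PiC : CompactSpace T.PiC := T.isProfiniteCompletion_toHat.compactSpace

/-- `Π_{C̲̲}` has finite index in `Π_C` (an open subgroup of the compact group `Π_C`; `C̲̲ → C` is a finite
covering, Def 2.3). [cite: MochizukiEtTh2009, Def 2.3 p.38] -/
theorem finiteIndex_PiCuu : T.PiCuu.FiniteIndex := by
  haveI := T.compactSpace_PiC
  haveI : Finite (T.PiC ⧸ T.PiCuu) := Subgroup.quotient_finite_of_isOpen _ T.isOpen_PiCuu'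
  exact Subgroup.finiteIndex_of_finite_quotient

/-- `Π_{X̲̲} = Π_{C̲̲} ∩ Π_X` has finite index in `Π_C` (`X̲̲ → C` is a finite covering, Def 2.3).
[cite: MochizukiEtTh2009, Def 2.3 p.38] -/
theorem finiteIndex_PiXuu : T.PiXuu.FiniteIndex := by
  haveI := T.compactSpace_PiC
  haveI : Finite (T.PiC ⧸ T.PiXuu) :=
    Subgroup.quotient_finite_of_isOpen _ (T.isOpen_PiCuu'.inter T.isOpen_PiX)
  exact Subgroup.finiteIndex_of_finite_quotient

end TemperedCoverData

end ThetaCovers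

end Literature.AnabelianGeometry.EtaleTheta
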